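import Summits.QuantumFields.YangMills.Theorems.SwapVirialDeficitZeroModeGroupThreeSmallBallRateFlips
import HarnessLib

/-!
# Exact zero-mode rung Z4 in SMALL-BALL form — VII-b: the coupled layer (separable singular weight) and the volumes of the five layers
# (LEAD ym-line-sfw-p2 g93 07:46Z «`Haar³{N₃(t)} = v₃t⁴(1 + O(t^θ))`»; free-hands support of ⟨stmt-QuantumFields-24197⟩)

* §15c the coupled layer's width `2√(2(s r⁻⁴)/(y₀²+y_I²))` is bounded by the SEPARABLE singular weight
  `(2√2√s/r²)·(y₀²)^{-1/4}(y_I²)^{-1/4}` (AM–GM ★ `inv_sqrt_le_rpow_mul`), written with w2 g55's `⊤`-valued ✓`singPow ¼` so that it holds everywhere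
  (★ `coupled_indicator_le`), and its integral factorises into ✓`Ising ¼`'s and box volumes (★ `lintegral_coupledBound`);
  measurability of the five layers, ★ `volume_layerC_le` (`≤ (2√2√s/r²)·I(¼)·2I(¼)·r⁻⁴`), ★ `volume_layers_BH_le` (each `≤ (2√s/r)(8/r⁴)`).
Part VII-c: the inclusion `G_sΔG₀ ⊆ layers ∪ null` and the per-hub bound; part VIII: hub integrals and the rate.
HONEST LABEL: finite-dimensional measure theory (plan-level zero-mode rung of a DRAFT line); NOT ⟨24197⟩; the Yang–Mills mass gap is NOT proved; no summit
is proved by a line.  Seat ym-line-fcl-p3 g44, `--supports stmt-QuantumFields-24197`.  THEOREMS ONLY, standard axioms.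
References: [cite: GonzalezarroyoAltes1988]; [cite: Vanbaal2001]; [folklore].
-/

set_option autoImplicit false

noncomputable section

open MeasureTheory Quaternion Set Filter Topology
open scoped Quaternion ENNReal BigOperators Topology
open Literature.MathematicalPhysics.QuantumLattice
open Summit.QuantumFields.YangMills.Theorems.SwapTwistDeficit.ToronLog

attribute [local instance] Literature.Analysis.FluidPDE.Tao2016.quatMeasurableSpace
  Literature.Analysis.FluidPDE.Tao2016.quatBorelSpace
  Literature.MathematicalPhysics.QuantumLattice.secondCountableTopology_su2

namespace Summit.QuantumFields.YangMills.Theorems.SwapVirialDeficit.ZeroModeGroup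
/-! ## §15c The coupled layer: the `(y₀² + y_I²)^{-1/2}` singularity is separable -/

/-- `(u²)^{1/4} = √|u|`. [folklore] -/
theorem sq_rpow_quarter (u : ℝ) : (u ^ 2) ^ ((1 : ℝ) / 4) = Real.sqrt |u| := by
  rw [show u ^ 2 = |u| ^ 2 from (sq_abs u).symm, ← Real.rpow_natCast |u| 2, ← Real.rpow_mul (abs_nonneg u), Real.sqrt_eq_rpow]
  norm_num

/-- AM–GM for the inverse root: `1/√(y₀² + y₁²) ≤ (y₀²)^{−1/4}·(y₁²)^{−1/4}` (`y₀, y₁ ≠ 0`). [folklore] -/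
theorem inv_sqrt_le_rpow_mul {y₀ y₁ : ℝ} (h0 : y₀ ≠ 0) (h1 : y₁ ≠ 0) :
    1 / Real.sqrt (y₀ ^ 2 + y₁ ^ 2) ≤ (y₀ ^ 2) ^ (-((1 : ℝ) / 4)) * (y₁ ^ 2) ^ (-((1 : ℝ) / 4)) := by
  have ha0 : 0 < |y₀| := abs_pos.2 h0
  have ha1 : 0 < |y₁| := abs_pos.2 h1
  rw [Real.rpow_neg (sq_nonneg _), Real.rpow_neg (sq_nonneg _), sq_rpow_quarter, sq_rpow_quarter, ← mul_inv,
    ← Real.sqrt_mul (abs_nonneg _), one_div]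
  have hpos : 0 < Real.sqrt (|y₀| * |y₁|) := Real.sqrt_pos.2 (mul_pos ha0 ha1)
  rw [inv_le_inv₀ (Real.sqrt_pos.2 (by positivity)) hpos]
  refine Real.sqrt_le_sqrt ?_
  rw [← abs_mul]
  nlinarith [abs_mul_abs_self (y₀ * y₁), sq_abs (y₀ * y₁), sq_nonneg (|y₀| - |y₁|), abs_nonneg (y₀ * y₁), sq_abs y₀, sq_abs y₁, abs_mul y₀ y₁]

/-- The width bound of the coupled layer: `2√(2(s r⁻⁴)/(y₀²+y_I²)) ≤ (2√2·√s/r²)·(y₀²)^{−1/4}(y_I²)^{−1/4}` (`y₀, y_I ≠ 0`, `r > 0`, `s ≥ 0`). [folklore] -/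
theorem coupled_width_le {r s y₀ y₁ : ℝ} (hr : 0 < r) (hs : 0 ≤ s) (h0 : y₀ ≠ 0) (h1 : y₁ ≠ 0) :
    2 * Real.sqrt (2 * (s * (r ^ 4)⁻¹) / (y₀ ^ 2 + y₁ ^ 2)) ≤
      (2 * Real.sqrt 2 * Real.sqrt s / r ^ 2) * ((y₀ ^ 2) ^ (-((1 : ℝ) / 4)) * (y₁ ^ 2) ^ (-((1 : ℝ) / 4))) := by
  have hN : 0 < y₀ ^ 2 + y₁ ^ 2 := by positivity
  have e : Real.sqrt (2 * (s * (r ^ 4)⁻¹) / (y₀ ^ 2 + y₁ ^ 2)) = Real.sqrt 2 * Real.sqrt s / r ^ 2 * (1 / Real.sqrt (y₀ ^ 2 + y₁ ^ 2)) := by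
    rw [Real.sqrt_div' _ hN.le, Real.sqrt_mul (by norm_num), Real.sqrt_mul hs, Real.sqrt_inv, show r ^ 4 = (r ^ 2) ^ 2 by ring,
      Real.sqrt_sq (by positivity)]
    field_simp
  rw [e]
  have hc : 0 ≤ 2 * (Real.sqrt 2 * Real.sqrt s / r ^ 2) := by positivity
  calc 2 * (Real.sqrt 2 * Real.sqrt s / r ^ 2 * (1 / Real.sqrt (y₀ ^ 2 + y₁ ^ 2)))
      = 2 * (Real.sqrt 2 * Real.sqrt s / r ^ 2) * (1 / Real.sqrt (y₀ ^ 2 + y₁ ^ 2)) := by ring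
    _ ≤ 2 * (Real.sqrt 2 * Real.sqrt s / r ^ 2) * ((y₀ ^ 2) ^ (-((1 : ℝ) / 4)) * (y₁ ^ 2) ^ (-((1 : ℝ) / 4))) :=
        mul_le_mul_of_nonneg_left (inv_sqrt_le_rpow_mul h0 h1) hc
    _ = _ := by ring

/-- The separable bound for the coupled layer's width function on the window (`⊤`-valued weights make it hold everywhere). [folklore] -/
theorem coupled_indicator_le {r s : ℝ} (hr : 0 < r) (hs : 0 < s) (q : ℝ × ((ℝ × ℝ) × ((ℝ × ℝ) × (ℝ × ℝ)))) :
    (window r).indicator (fun q => ENNReal.ofReal (2 * Real.sqrt (2 * (s * (r ^ 4)⁻¹) / (q.1 ^ 2 + q.2.1.2 ^ 2)))) q ≤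
      ENNReal.ofReal (2 * Real.sqrt 2 * Real.sqrt s / r ^ 2) *
        (({u : ℝ | u ^ 2 < 1}.indicator (singPow (1/4)) q.1) *
          (({u : ℝ | u ^ 2 < 1}.indicator (fun _ => (1 : ℝ≥0∞)) q.2.1.1 * {u : ℝ | u ^ 2 < 1}.indicator (singPow (1/4)) q.2.1.2) *
            (({u : ℝ | u ^ 2 < 1 / (4 * r ^ 2)} ×ˢ {u : ℝ | u ^ 2 < 1 / (4 * r ^ 2)}) ×ˢ
              ({u : ℝ | u ^ 2 < 1 / (4 * r ^ 2)} ×ˢ {u : ℝ | u ^ 2 < 1 / (4 * r ^ 2)})).indicator (fun _ => (1 : ℝ≥0∞)) q.2.2)) := by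
  by_cases hq : q ∈ window r
  · rw [Set.indicator_of_mem hq]
    obtain ⟨h0, ⟨hI1, hI2⟩, hbox⟩ := hq
    rw [Set.indicator_of_mem h0, Set.indicator_of_mem hI1, Set.indicator_of_mem hI2, Set.indicator_of_mem hbox, one_mul, mul_one]
    have hc : 0 < 2 * Real.sqrt 2 * Real.sqrt s / r ^ 2 := by
      have := Real.sqrt_pos.2 hs; positivity
    have hcne : ENNReal.ofReal (2 * Real.sqrt 2 * Real.sqrt s / r ^ 2) ≠ 0 := (ENNReal.ofReal_pos.2 hc).ne'
    by_cases hy0 : q.1 = 0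
    · rw [hy0, singPow_zero, ENNReal.top_mul (singPow_ne_zero _ _), ENNReal.mul_top hcne]; exact le_top
    by_cases hy1 : q.2.1.2 = 0
    · rw [hy1, singPow_zero, ENNReal.mul_top (singPow_ne_zero _ _), ENNReal.mul_top hcne]; exact le_top
    rw [singPow_of_ne hy0, singPow_of_ne hy1, ← ENNReal.ofReal_mul (Real.rpow_nonneg (sq_nonneg _) _), ← ENNReal.ofReal_mul hc.le]
    exact ENNReal.ofReal_le_ofReal (coupled_width_le hr hs.le hy0 hy1)
  · rw [Set.indicator_of_notMem hq]; exact bot_le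

/-- The separable bound is measurable. [folklore] -/
theorem measurable_coupledBound (r s : ℝ) : Measurable fun q : ℝ × ((ℝ × ℝ) × ((ℝ × ℝ) × (ℝ × ℝ))) =>
    ENNReal.ofReal (2 * Real.sqrt 2 * Real.sqrt s / r ^ 2) *
      (({u : ℝ | u ^ 2 < 1}.indicator (singPow (1/4)) q.1) *
        (({u : ℝ | u ^ 2 < 1}.indicator (fun _ => (1 : ℝ≥0∞)) q.2.1.1 * {u : ℝ | u ^ 2 < 1}.indicator (singPow (1/4)) q.2.1.2) *
          (({u : ℝ | u ^ 2 < 1 / (4 * r ^ 2)} ×ˢ {u : ℝ | u ^ 2 < 1 / (4 * r ^ 2)}) ×ˢ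
            ({u : ℝ | u ^ 2 < 1 / (4 * r ^ 2)} ×ˢ {u : ℝ | u ^ 2 < 1 / (4 * r ^ 2)})).indicator (fun _ => (1 : ℝ≥0∞)) q.2.2)) := by
  have hb := measurable_boxSing (1/4)
  have hbox : MeasurableSet (({u : ℝ | u ^ 2 < 1 / (4 * r ^ 2)} ×ˢ {u : ℝ | u ^ 2 < 1 / (4 * r ^ 2)}) ×ˢ
      ({u : ℝ | u ^ 2 < 1 / (4 * r ^ 2)} ×ˢ {u : ℝ | u ^ 2 < 1 / (4 * r ^ 2)})) :=
    ((measurableSet_sqLt _).prod (measurableSet_sqLt _)).prod ((measurableSet_sqLt _).prod (measurableSet_sqLt _))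
  refine measurable_const.mul ((hb.comp measurable_fst).mul ((((measurable_const.indicator (measurableSet_sqLt 1)).comp
    (measurable_fst.comp (measurable_fst.comp measurable_snd))).mul (hb.comp (measurable_snd.comp (measurable_fst.comp measurable_snd)))).mul
      ((measurable_const.indicator hbox).comp (measurable_snd.comp measurable_snd))))

/-- The integral of the separable bound: `(2√2·√s/r²)·I(¼)·(2·I(¼))·r⁻⁴`. [folklore] -/
theorem lintegral_coupledBound {r s : ℝ} (hr : 0 < r) :
    ∫⁻ q : ℝ × ((ℝ × ℝ) × ((ℝ × ℝ) × (ℝ × ℝ))), ENNReal.ofReal (2 * Real.sqrt 2 * Real.sqrt s / r ^ 2) *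
      (({u : ℝ | u ^ 2 < 1}.indicator (singPow (1/4)) q.1) *
        (({u : ℝ | u ^ 2 < 1}.indicator (fun _ => (1 : ℝ≥0∞)) q.2.1.1 * {u : ℝ | u ^ 2 < 1}.indicator (singPow (1/4)) q.2.1.2) *
          (({u : ℝ | u ^ 2 < 1 / (4 * r ^ 2)} ×ˢ {u : ℝ | u ^ 2 < 1 / (4 * r ^ 2)}) ×ˢ
            ({u : ℝ | u ^ 2 < 1 / (4 * r ^ 2)} ×ˢ {u : ℝ | u ^ 2 < 1 / (4 * r ^ 2)})).indicator (fun _ => (1 : ℝ≥0∞)) q.2.2)) =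
      ENNReal.ofReal (2 * Real.sqrt 2 * Real.sqrt s / r ^ 2) * (Ising (1/4) * ((2 * Ising (1/4)) * ENNReal.ofReal (1 / r ^ 4))) := by
  have hb := measurable_boxSing (1/4)
  have hbox : MeasurableSet (({u : ℝ | u ^ 2 < 1 / (4 * r ^ 2)} ×ˢ {u : ℝ | u ^ 2 < 1 / (4 * r ^ 2)}) ×ˢ
      ({u : ℝ | u ^ 2 < 1 / (4 * r ^ 2)} ×ˢ {u : ℝ | u ^ 2 < 1 / (4 * r ^ 2)})) :=
    ((measurableSet_sqLt _).prod (measurableSet_sqLt _)).prod ((measurableSet_sqLt _).prod (measurableSet_sqLt _))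
  have hmid : Measurable fun v : ℝ × ℝ => {u : ℝ | u ^ 2 < 1}.indicator (fun _ => (1 : ℝ≥0∞)) v.1 * {u : ℝ | u ^ 2 < 1}.indicator (singPow (1/4)) v.2 :=
    ((measurable_const.indicator (measurableSet_sqLt 1)).comp measurable_fst).mul (hb.comp measurable_snd)
  have hlast : Measurable fun v : (ℝ × ℝ) × (ℝ × ℝ) => (({u : ℝ | u ^ 2 < 1 / (4 * r ^ 2)} ×ˢ {u : ℝ | u ^ 2 < 1 / (4 * r ^ 2)}) ×ˢ
      ({u : ℝ | u ^ 2 < 1 / (4 * r ^ 2)} ×ˢ {u : ℝ | u ^ 2 < 1 / (4 * r ^ 2)})).indicator (fun _ => (1 : ℝ≥0∞)) v :=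
    measurable_const.indicator hbox
  have hG : Measurable (fun w : (ℝ × ℝ) × ((ℝ × ℝ) × (ℝ × ℝ)) =>
      ({u : ℝ | u ^ 2 < 1}.indicator (fun _ => (1 : ℝ≥0∞)) w.1.1 * {u : ℝ | u ^ 2 < 1}.indicator (singPow (1/4)) w.1.2) *
        (({u : ℝ | u ^ 2 < 1 / (4 * r ^ 2)} ×ˢ {u : ℝ | u ^ 2 < 1 / (4 * r ^ 2)}) ×ˢ
          ({u : ℝ | u ^ 2 < 1 / (4 * r ^ 2)} ×ˢ {u : ℝ | u ^ 2 < 1 / (4 * r ^ 2)})).indicator (fun _ => (1 : ℝ≥0∞)) w.2) := by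
    exact (hmid.comp measurable_fst).mul (hlast.comp measurable_snd)
  have hF : Measurable (fun q : ℝ × ((ℝ × ℝ) × ((ℝ × ℝ) × (ℝ × ℝ))) =>
      ({u : ℝ | u ^ 2 < 1}.indicator (singPow (1/4)) q.1) *
        (({u : ℝ | u ^ 2 < 1}.indicator (fun _ => (1 : ℝ≥0∞)) q.2.1.1 * {u : ℝ | u ^ 2 < 1}.indicator (singPow (1/4)) q.2.1.2) *
          (({u : ℝ | u ^ 2 < 1 / (4 * r ^ 2)} ×ˢ {u : ℝ | u ^ 2 < 1 / (4 * r ^ 2)}) ×ˢ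
            ({u : ℝ | u ^ 2 < 1 / (4 * r ^ 2)} ×ˢ {u : ℝ | u ^ 2 < 1 / (4 * r ^ 2)})).indicator (fun _ => (1 : ℝ≥0∞)) q.2.2)) := by
    exact (hb.comp measurable_fst).mul (hG.comp measurable_snd)
  rw [lintegral_const_mul _ hF]
  congr 1
  rw [lintegral_volume_prod_mul (f := fun u : ℝ => {u : ℝ | u ^ 2 < 1}.indicator (singPow (1/4)) u)
    (g := fun w : (ℝ × ℝ) × ((ℝ × ℝ) × (ℝ × ℝ)) =>
      ({u : ℝ | u ^ 2 < 1}.indicator (fun _ => (1 : ℝ≥0∞)) w.1.1 * {u : ℝ | u ^ 2 < 1}.indicator (singPow (1/4)) w.1.2) *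
        (({u : ℝ | u ^ 2 < 1 / (4 * r ^ 2)} ×ˢ {u : ℝ | u ^ 2 < 1 / (4 * r ^ 2)}) ×ˢ
          ({u : ℝ | u ^ 2 < 1 / (4 * r ^ 2)} ×ˢ {u : ℝ | u ^ 2 < 1 / (4 * r ^ 2)})).indicator (fun _ => (1 : ℝ≥0∞)) w.2) hb hG]
  congr 1
  rw [lintegral_volume_prod_mul (f := fun v : ℝ × ℝ => {u : ℝ | u ^ 2 < 1}.indicator (fun _ => (1 : ℝ≥0∞)) v.1 * {u : ℝ | u ^ 2 < 1}.indicator (singPow (1/4)) v.2)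
    (g := fun v : (ℝ × ℝ) × (ℝ × ℝ) => (({u : ℝ | u ^ 2 < 1 / (4 * r ^ 2)} ×ˢ {u : ℝ | u ^ 2 < 1 / (4 * r ^ 2)}) ×ˢ
      ({u : ℝ | u ^ 2 < 1 / (4 * r ^ 2)} ×ˢ {u : ℝ | u ^ 2 < 1 / (4 * r ^ 2)})).indicator (fun _ => (1 : ℝ≥0∞)) v) hmid hlast,
    lintegral_volume_prod_mul (f := fun u : ℝ => {u : ℝ | u ^ 2 < 1}.indicator (fun _ => (1 : ℝ≥0∞)) u)
      (g := fun u : ℝ => {u : ℝ | u ^ 2 < 1}.indicator (singPow (1/4)) u) (measurable_const.indicator (measurableSet_sqLt 1)) hb,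
    lintegral_indicator_const (measurableSet_sqLt 1), volume_sqBox_one, one_mul, lintegral_indicator_const hbox, one_mul]
  congr 1
  simp only [Measure.volume_eq_prod, Measure.prod_prod, volume_sqLt_quarter hr, ← ENNReal.ofReal_mul (show (0 : ℝ) ≤ 1 / r by positivity),
    ← ENNReal.ofReal_mul (show (0 : ℝ) ≤ 1 / r * (1 / r) by positivity)]
  congr 1; field_simp


/-- The coupled layer set is measurable. [folklore] -/
theorem measurableSet_layerC (r s : ℝ) : MeasurableSet (layerC r s) := by
  have hw : Measurable fun p : (ℝ × ℝ) × ((ℝ × ℝ) × ((ℝ × ℝ) × (ℝ × ℝ))) => (p.1.2, p.2) := (measurable_snd.comp measurable_fst).prodMk measurable_snd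
  have hN : Measurable fun p : (ℝ × ℝ) × ((ℝ × ℝ) × ((ℝ × ℝ) × (ℝ × ℝ))) => p.1.2 ^ 2 + p.2.1.2 ^ 2 := by fun_prop
  have hx0 : Measurable fun p : (ℝ × ℝ) × ((ℝ × ℝ) × ((ℝ × ℝ) × (ℝ × ℝ))) => p.1.1 ^ 2 := by fun_prop
  have hg : Measurable fun p : (ℝ × ℝ) × ((ℝ × ℝ) × ((ℝ × ℝ) × (ℝ × ℝ))) =>
      4 * pC p.2 / (p.1.2 ^ 2 + p.2.1.2 ^ 2) - (s * (r ^ 4)⁻¹) / (p.1.2 ^ 2 + p.2.1.2 ^ 2) - p.2.1.1 ^ 2 :=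
    (((measurable_pC.comp measurable_snd).const_mul _).div hN |>.sub (measurable_const.div hN)).sub (by fun_prop)
  have he : Measurable fun p : (ℝ × ℝ) × ((ℝ × ℝ) × ((ℝ × ℝ) × (ℝ × ℝ))) => 2 * (s * (r ^ 4)⁻¹) / (p.1.2 ^ 2 + p.2.1.2 ^ 2) :=
    measurable_const.div hN
  unfold layerC
  refine ((measurableSet_window r).preimage hw).inter ((measurableSet_lt measurable_const hN).inter
    ((measurableSet_le hg hx0).inter (measurableSet_le hx0 (hg.add he))))

/-- ★ **Volume of the coupled layer**: `vol(layerC r s) ≤ (2√2·√s/r²)·I(¼)·(2I(¼))·r⁻⁴` (`r, s > 0`). [folklore] -/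
theorem volume_layerC_le {r s : ℝ} (hr : 0 < r) (hs : 0 < s) :
    (volume : Measure ((ℝ × ℝ) × ((ℝ × ℝ) × ((ℝ × ℝ) × (ℝ × ℝ))))) (layerC r s) ≤
      ENNReal.ofReal (2 * Real.sqrt 2 * Real.sqrt s / r ^ 2) * (Ising (1/4) * ((2 * Ising (1/4)) * ENNReal.ofReal (1 / r ^ 4))) := by
  have hN : Measurable fun q : ℝ × ((ℝ × ℝ) × ((ℝ × ℝ) × (ℝ × ℝ))) => q.1 ^ 2 + q.2.1.2 ^ 2 := by fun_prop
  have hF : Measurable fun q : ℝ × ((ℝ × ℝ) × ((ℝ × ℝ) × (ℝ × ℝ))) =>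
      (window r).indicator (fun q => ENNReal.ofReal (2 * Real.sqrt (2 * (s * (r ^ 4)⁻¹) / (q.1 ^ 2 + q.2.1.2 ^ 2)))) q := by
    refine Measurable.indicator ?_ (measurableSet_window r)
    exact ENNReal.measurable_ofReal.comp (measurable_const.mul (Real.continuous_sqrt.measurable.comp (measurable_const.div hN)))
  refine (volume_coordLayer_le_lintegral (measurableSet_layerC r s) (W := window r)
    (fun q => 4 * pC q.2 / (q.1 ^ 2 + q.2.1.2 ^ 2) - (s * (r ^ 4)⁻¹) / (q.1 ^ 2 + q.2.1.2 ^ 2) - q.2.1.1 ^ 2)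
    (fun q => 2 * (s * (r ^ 4)⁻¹) / (q.1 ^ 2 + q.2.1.2 ^ 2)) (fun q => by positivity) (fun x₀ y₀ w hp => ?_) hF).trans ?_
  · exact ⟨hp.1, hp.2.2.1, hp.2.2.2⟩
  · exact (lintegral_mono (coupled_indicator_le hr hs)).trans (le_of_eq (lintegral_coupledBound hr))

/-- The `x`-ball layer set is measurable. [folklore] -/
theorem measurableSet_layerBX (r s : ℝ) : MeasurableSet (layerBX r s) := by
  have hw : Measurable fun p : (ℝ × ℝ) × ((ℝ × ℝ) × ((ℝ × ℝ) × (ℝ × ℝ))) => (p.1.2, p.2) := (measurable_snd.comp measurable_fst).prodMk measurable_snd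
  have hx0 : Measurable fun p : (ℝ × ℝ) × ((ℝ × ℝ) × ((ℝ × ℝ) × (ℝ × ℝ))) => p.1.1 ^ 2 := by fun_prop
  have hg : Measurable fun p : (ℝ × ℝ) × ((ℝ × ℝ) × ((ℝ × ℝ) × (ℝ × ℝ))) => 1 - p.2.1.1 ^ 2 - s * xT p.2 :=
    (measurable_const.sub (by fun_prop)).sub ((measurable_xT.comp measurable_snd).const_mul s)
  have he : Measurable fun p : (ℝ × ℝ) × ((ℝ × ℝ) × ((ℝ × ℝ) × (ℝ × ℝ))) => s * xT p.2 := (measurable_xT.comp measurable_snd).const_mul s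
  unfold layerBX
  exact ((measurableSet_window r).preimage hw).inter ((measurableSet_le hg hx0).inter (measurableSet_le hx0 (hg.add he)))

/-- The `x`-hub layer set is measurable. [folklore] -/
theorem measurableSet_layerHX (r ρ s : ℝ) : MeasurableSet (layerHX r ρ s) := by
  have hw : Measurable fun p : (ℝ × ℝ) × ((ℝ × ℝ) × ((ℝ × ℝ) × (ℝ × ℝ))) => (p.1.2, p.2) := (measurable_snd.comp measurable_fst).prodMk measurable_snd
  have hx0 : Measurable fun p : (ℝ × ℝ) × ((ℝ × ℝ) × ((ℝ × ℝ) × (ℝ × ℝ))) => p.1.1 ^ 2 := by fun_prop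
  have hg : Measurable fun p : (ℝ × ℝ) × ((ℝ × ℝ) × ((ℝ × ℝ) × (ℝ × ℝ))) => 4 * r ^ 2 * xT p.2 / ρ ^ 2 - p.2.1.1 ^ 2 - s * xT p.2 :=
    ((((measurable_xT.comp measurable_snd).const_mul _).div_const _).sub (by fun_prop)).sub ((measurable_xT.comp measurable_snd).const_mul s)
  have he : Measurable fun p : (ℝ × ℝ) × ((ℝ × ℝ) × ((ℝ × ℝ) × (ℝ × ℝ))) => s * xT p.2 := (measurable_xT.comp measurable_snd).const_mul s
  unfold layerHX
  exact ((measurableSet_window r).preimage hw).inter ((measurableSet_le hg hx0).inter (measurableSet_le hx0 (hg.add he)))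

/-- The `y`-ball layer set is measurable. [folklore] -/
theorem measurableSet_layerBY (r s : ℝ) : MeasurableSet (layerBY r s) := by
  have hw : Measurable fun p : (ℝ × ℝ) × ((ℝ × ℝ) × ((ℝ × ℝ) × (ℝ × ℝ))) => (p.1.1, p.2) := (measurable_fst.comp measurable_fst).prodMk measurable_snd
  have hy0 : Measurable fun p : (ℝ × ℝ) × ((ℝ × ℝ) × ((ℝ × ℝ) × (ℝ × ℝ))) => p.1.2 ^ 2 := by fun_prop
  have hg : Measurable fun p : (ℝ × ℝ) × ((ℝ × ℝ) × ((ℝ × ℝ) × (ℝ × ℝ))) => 1 - p.2.1.2 ^ 2 - s * yT p.2 :=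
    (measurable_const.sub (by fun_prop)).sub ((measurable_yT.comp measurable_snd).const_mul s)
  have he : Measurable fun p : (ℝ × ℝ) × ((ℝ × ℝ) × ((ℝ × ℝ) × (ℝ × ℝ))) => s * yT p.2 := (measurable_yT.comp measurable_snd).const_mul s
  unfold layerBY
  exact ((measurableSet_window r).preimage hw).inter ((measurableSet_le hg hy0).inter (measurableSet_le hy0 (hg.add he)))

/-- The `y`-hub layer set is measurable. [folklore] -/
theorem measurableSet_layerHY (r ρ s : ℝ) : MeasurableSet (layerHY r ρ s) := by
  have hw : Measurable fun p : (ℝ × ℝ) × ((ℝ × ℝ) × ((ℝ × ℝ) × (ℝ × ℝ))) => (p.1.1, p.2) := (measurable_fst.comp measurable_fst).prodMk measurable_snd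
  have hy0 : Measurable fun p : (ℝ × ℝ) × ((ℝ × ℝ) × ((ℝ × ℝ) × (ℝ × ℝ))) => p.1.2 ^ 2 := by fun_prop
  have hg : Measurable fun p : (ℝ × ℝ) × ((ℝ × ℝ) × ((ℝ × ℝ) × (ℝ × ℝ))) => 4 * r ^ 2 * yT p.2 / ρ ^ 2 - p.2.1.2 ^ 2 - s * yT p.2 :=
    ((((measurable_yT.comp measurable_snd).const_mul _).div_const _).sub (by fun_prop)).sub ((measurable_yT.comp measurable_snd).const_mul s)
  have he : Measurable fun p : (ℝ × ℝ) × ((ℝ × ℝ) × ((ℝ × ℝ) × (ℝ × ℝ))) => s * yT p.2 := (measurable_yT.comp measurable_snd).const_mul s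
  unfold layerHY
  exact ((measurableSet_window r).preimage hw).inter ((measurableSet_le hg hy0).inter (measurableSet_le hy0 (hg.add he)))

/-- ★ Volumes of the four ball/hub layers: each `≤ (2√s/r)·(8/r⁴)` (`r > 0`, `s ≥ 0`). [folklore] -/
theorem volume_layers_BH_le {r ρ s : ℝ} (hr : 0 < r) (hs : 0 ≤ s) :
    (volume : Measure ((ℝ × ℝ) × ((ℝ × ℝ) × ((ℝ × ℝ) × (ℝ × ℝ))))) (layerBX r s) ≤ ENNReal.ofReal (2 * Real.sqrt s / r) * ENNReal.ofReal (8 / r ^ 4) ∧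
    (volume : Measure ((ℝ × ℝ) × ((ℝ × ℝ) × ((ℝ × ℝ) × (ℝ × ℝ))))) (layerHX r ρ s) ≤ ENNReal.ofReal (2 * Real.sqrt s / r) * ENNReal.ofReal (8 / r ^ 4) ∧
    (volume : Measure ((ℝ × ℝ) × ((ℝ × ℝ) × ((ℝ × ℝ) × (ℝ × ℝ))))) (layerBY r s) ≤ ENNReal.ofReal (2 * Real.sqrt s / r) * ENNReal.ofReal (8 / r ^ 4) ∧
    (volume : Measure ((ℝ × ℝ) × ((ℝ × ℝ) × ((ℝ × ℝ) × (ℝ × ℝ))))) (layerHY r ρ s) ≤ ENNReal.ofReal (2 * Real.sqrt s / r) * ENNReal.ofReal (8 / r ^ 4) := by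
  refine ⟨?_, ?_, ?_, ?_⟩
  · exact volume_layerXtype_le hr hs (measurableSet_layerBX r s) (fun q => 1 - q.2.1.1 ^ 2 - s * xT q.2) fun x₀ y₀ w hp => hp
  · exact volume_layerXtype_le hr hs (measurableSet_layerHX r ρ s) (fun q => 4 * r ^ 2 * xT q.2 / ρ ^ 2 - q.2.1.1 ^ 2 - s * xT q.2)
      fun x₀ y₀ w hp => hp
  · exact volume_layerYtype_le hr hs (measurableSet_layerBY r s) (fun q => 1 - q.2.1.2 ^ 2 - s * yT q.2) fun x₀ y₀ w hp => hp
  · exact volume_layerYtype_le hr hs (measurableSet_layerHY r ρ s) (fun q => 4 * r ^ 2 * yT q.2 / ρ ^ 2 - q.2.1.2 ^ 2 - s * yT q.2)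
      fun x₀ y₀ w hp => hp


end Summit.QuantumFields.YangMills.Theorems.SwapVirialDeficit.ZeroModeGroup

end
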